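import Summits.ResolutionOfSingularities.ResolutionOfSingularities.Theses.Valuative
import Summits.ResolutionOfSingularities.ResolutionOfSingularities.Theorems.FrobeniusClosingSteerJacobianThinness
import Summits.ResolutionOfSingularities.ResolutionOfSingularities.Theorems.FrobeniusClosingSteerCore4RunTrichotomy
import Summits.ResolutionOfSingularities.ResolutionOfSingularities.Theorems.FrobeniusClosingSteerCore4OrderOneExit
import Summits.ResolutionOfSingularities.ResolutionOfSingularities.Theorems.FrobeniusClosingSteerCore4GenExit
import Summits.ResolutionOfSingularities.ResolutionOfSingularities.Theorems.ValuativeLuAlphaPTorsorDenseRangeFinal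
import Summits.ResolutionOfSingularities.ResolutionOfSingularities.Theorems.ValuativeLuAlphaPTorsorDimTwoTransport
import Summits.ResolutionOfSingularities.ResolutionOfSingularities.Theorems.ValuativeLuAlphaPTorsorSequenceSchema
import Summits.ResolutionOfSingularities.ResolutionOfSingularities.Theorems.ValuativeLuAlphaPTorsorLogPrincipalizationLowDim
import Summits.ResolutionOfSingularities.ResolutionOfSingularities.Theorems.ValuativeLuAlphaPTorsorBirationalExit
import Summits.ResolutionOfSingularities.ResolutionOfSingularities.Theorems.ValuativeLuAlphaPTorsorDiscreteAllDimHelpers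
import Mathlib.FieldTheory.Perfect
import Mathlib.FieldTheory.IntermediateField.Adjoin.Algebra
import HarnessLib

/-!
# ThinnessCut — decomp-res lens-1 («grading / quantitative ladder»), generation 12, RESIDUAL MODE on the blocker

(decomp-res node «ThinnessCut» on host Valuative.LuAlphaPTorsor (stmt-0641): lens-1 g12 `ThinnessCut.lean` rev 3
sha256 98f17d8edf72d004; CRITIC-LEDGER
row 86 CLEARED-FOR-FILING (MAP +1; verdict carried to rev 3 by critic ACK 12:07:30Z).)

[WRITER NOTE (decomp-res writer g5).  Filed per the lens WRITER.md and critic row 86: namespace renamed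
`…Theses.ThinnessCut` →
`…Theorems.ThinnessCutClasses`, the dupNamespace option line and the two route-level deciding theorems (`closes`,
`closes_tame` — the route's
`Valuative.closes` stays the deciding theorem) dropped; everything else VERBATIM, split in three modules sharing
this namespace for the
Theorems line limit: THIS file = module docstring + §1 vocabulary + §2 pieces (`StallStartLU`, `StallLU`,
`EternalLU`, `ZenoLU`) + §3 necessity +
§4 order-one stages + §5 the rebasing transfer `stallLU_iff_stallStartLU`; `Theorems.ThinnessCutKernels` = §6 THE LAW
`infiniteThinness_of_discrete` / `eternalLU_iff_zenoLU` + §7 kernel `luAlphaPTorsor_iff_thinnessCut` + §8 the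
order axis (`TameStartLU`, `TameHyp`,
`luAlphaPTorsor_iff_tameCut`); `Theorems.ThinnessCutCharTwo` = §9 the `p = 2` perfect-ground-field slice
(`tameStartLU_inst_two`,
`stallStartLU_inst_two`).  Asides TameStartLU / ZenoLU refining 0641 on route Valuative are the Valuative planner's
call (signatures BY NAME
from these files).]

Host = `Valuative.LuAlphaPTorsor` (stmt-ResolutionOfSingularities-0641, crux rank 2, OPEN: relative local
uniformization of the `α_p`-torsor `tᵖ = a` over a finitely generated base `A₀` regular at the centre of a
valuation ring `O`), reached from the ROOT BY NAME through
`Valuative.closes (h₂ : LuAlphaPTorsor) (h₄ : TorsorToLurel) (h₃ : PatchingRel)`.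
This node CUTS the g11 residual `KangarooCoreLU` (critic row 98: located residual · IDEA-NEEDED · 0) with a
quantity the cell has not used: the **thinness** of the quadratic sequence of the base along the valuation
and the **Jacobian value budget** of a torsor run (tree, W4.1, `Theorems.SteerRankThinness.jacobianValueBudget`).

## The quantity (lens parameter) and its law (a TREE THEOREM, cited by name)
Along the quadratic sequence `R 0 = (A₀)_𝔭 ⊆ R 1 ⊆ ⋯ ⊆ O` of the base (`IsBaseSequence`), a STRICT STEP of the
radical `s_i = x_i · s_{i+1} + g_i` (`x_i` an exceptional parameter of `R i`, `g_i ∈ R i`,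
`s_{i+1}ᵖ ∈ R (i+1)`; tree `SteerRankThinness.IsStrictStep`) is possible exactly in the KANGAROO regime
(some `p`-th-power shift of the radicand divisible by `x_iᵖ`).  Leibniz gives `δ(s_iᵖ) = x_iᵖ · δ'(s_{i+1}ᵖ)`
for a corrected derivation `δ' = x δ` of `R (i+1)`, whence the **budget** `ν(δ(tᵖ)) ≤ ∏_{i<N} ν(x_i)^{p-1}`
for every run of length `N` and every `δ ∈ Der_ℤ(R 0)` (`jacobianValueBudget`), and its corollary
`not_isTorsorRun_of_infiniteThinness`: if the sequence has INFINITE THINNESS (`∏_{i<N} ν(x_i) → 0` in the value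
group, `SteerRankThinness.InfiniteThinness`) and some derivation sees the radicand, NO run is eternal.
Thinness `Σ_i (−log ν(x_i))` is the valuation-side twin of the Favre–Jonsson thinness / log-discrepancy
`A(ν) = Σ mᵢ` of an infinitely singular valuation; it is a GRADED QUANTITATIVE INVARIANT of the pair
(base, valuation), independent of the torsor, and it is what this lens files as its g12 axis.

## The cut (tree anchor F⁹, tree trichotomy, then thinness)
The tree anchor `PfaffLine.luAlphaPTorsor_iff_defectCoreFinal` (booked by this seat at g11) reduces the host
to its defect core: closed centre of base dimension `≥ 3`, valuation ZERO-DIMENSIONAL, NON-Abhyankar, NOT dense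
in a finitely generated Abhyankar subfield, NOT discrete (`CoreSide`: the four datum-free conditions, carried
by both pieces), radicand with no unit derivative and not a `p`-th power.  There the tree PROVES
(`SwitchingDichotomy.stub_core4RunTrichotomy`, all fields, all dimensions `≥ 3`): the base sequence exists and
the greedy strict run of `t` is ETERNAL, or reaches a stage in ORDER-ONE form, or STALLS (no strict step, not
order one).  ORDER-ONE stages are DECIDED IN TREE (`SwitchingDichotomy.orderOneExit`: adjoin a `p`-th root of
a regular parameter).  Hence (kernels below, 0 sorry):
* `luAlphaPTorsor_iff_thinnessCut : LuAlphaPTorsor ↔ StallStartLU ∧ ZenoLU`;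
* `stallLU_iff_stallStartLU : StallLU ↔ StallStartLU` — a stall at ANY stage is a stall AT THE BASE of a
  rebased datum (tree `SwitchingDichotomy.genRebase` + push-down), so the attackable piece is stated at stage 0;
* `eternalLU_iff_zenoLU : EternalLU ↔ ZenoLU` — THE LAW: an eternal strict run forces FINITE THINNESS of the
  base sequence, or the radicand is a `p`-th power at the centre (birational exit, tree `stub_birationalExit`);
  ingredients BY NAME: `not_isTorsorRun_of_infiniteThinness`, `PfaffLine.exists_derivation_apply_ne_zero`
  (non-`p`-th powers of a regular local ring essentially of finite type over ANY field of characteristic `p`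
  are seen by a `ℤ`-derivation), `PfaffLine.sequence_schema_of_ringHom`, `PfaffLine.exists_ringEquiv_atPrime`.
* rung: `infiniteThinness_of_discrete` — a discrete rank-one valuation has infinite thinness along every
  sequence of subrings; so the tree's discrete theorem (`PfaffLine.luAlphaPTorsor_of_discrete`, booked
  g11) lies on the NON-ETERNAL side, and `ZenoLU` is vacuous there;
* ORDER AXIS (§8): `stallStartLU_of_tameStartLU : TameStartLU → StallStartLU` — a stalled datum is
  ORDER-TAME at its base (every shift `tᵖ − gᵖ`, `g ∈ (A₀)_𝔭`, is a unit or lies in `𝔪² ∖ 𝔪ᵖ`), because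
  order `≥ p` steps (`canStep_of_mem_pow`: `𝔪ᵖ/xᵖ ⊆ R 1`) and order `1` is order-one form
  (`orderOneAt_of_mem_of_not_mem_sq`, via `PfaffLine.exists_rsop_cons`); hence the second kernel
  `luAlphaPTorsor_iff_tameCut : LuAlphaPTorsor ↔ TameStartLU ∧ ZenoLU`, whose attackable piece is g11's
  `TameOrderCoreLU` range (`2 ≤ b ≤ p−1`, critic row 98) plus the inert order-`0` class, stated on the local
  ring `locAtCentre A₀ O` with no sequence at all (hypothesis named `TameHyp`, pointwise law `tameHyp_of_stalled`);
* `p = 2` PERFECT-FIELD SLICE (§9, kernel): over a perfect ground field (`k = k̄`, `𝔽_q`, …) the order-tame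
  hypothesis is contradictory at `p = 2` (`not_tameHyp_two`, via `exists_sub_sq_lt_one`: zero-dimensionality +
  perfectness of `k⟮ā⟯` give a shift `t² − g²`, `g ∈ A₀`, of valuation `< 1`), so no datum is stalled at its base
  (`not_stalled_two`) and the `p = 2`, perfect-`k` instances of T′ and T hold VACUOUSLY (`tameStartLU_inst_two`,
  `stallStartLU_inst_two`): on that slice `ZenoLU` is the only piece of the cut.

## Pieces and tags (D-0171)
| piece | tag | evidence |
|---|---|---|
| `StallStartLU` (LU for a core-side datum STALLED AT ITS BASE: no strict step, not order one) | WEAKER(by letter: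
0641 restricted to a side condition; misses every kangaroo datum, i.e. 95/117 census specimens
`census/order/T-order-0.json`) · UNDECIDED · ATTACKABLE-L | over a PERFECT ground field = g11 `TameOrderCoreLU`
(`2 ≤ b ≤ p−1`) moved to stage 0 by the PROVED rebasing (order `≥ p` ⇒ a strict step exists; order `1` ⇒
order-one form; order `0` ⇒ inert residue extension, impossible at a closed centre over perfect `k`); engine E2
(multiplicity `< p` ⇒ maximal contact, Kollár 2007 Aside 3.57 p.144, verified critic row 98); over IMPERFECT `k`
it also holds the inert stalls `b = 0` |
| `ZenoLU` (LU for a core-side datum with an ETERNAL strict run along a base sequence of FINITE thinness) | located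
residual · WEAKER(by letter; side condition never met on discrete valuations: `zeno_vacuous_of_discrete`) ·
UNDECIDED · IDEA-NEEDED / BARRIER | Cossart 2011 (no maximal contact at order `p` along a valuation:
[corpus:paper:cossart2011-is-there-notion-weak-maximal-contact-characteristic p.2, §III pp.6–7]) ·
`Literature.Barriers.ResolutionOfSingularities.DimensionFourFrontier` |
| `TameStartLU` (LU for a core-side datum ORDER-TAME AT ITS BASE: every shift a unit or in `𝔪² ∖ 𝔪ᵖ`) |
WEAKER · UNDECIDED · ATTACKABLE-L; implies `StallStartLU` (PROVED), kernel-complete with `ZenoLU`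
(`luAlphaPTorsor_iff_tameCut`); VACUOUS at `p = 2` over perfect `k` (`tameStartLU_inst_two`, kernel) | the
ORDER-AXIS form the writer should file (continuity with g11 `TameOrderCoreLU`; no run vocabulary needed) |
| `StallLU`, `EternalLU` | recompositions (kernels `stallLU_iff_stallStartLU`, `eternalLU_iff_zenoLU`) — NOT to be
filed separately | |
| order-one stages, base dim `≤ 2` | DECIDED IN TREE (`orderOne_concl`,
`PfaffLine.luAlphaPTorsor_of_ringKrullDim_le_two`) | no piece |

WHY EACH PIECE IS STRICTLY WEAKER THAN THE HOST: each is `0641` restricted to an extra hypothesis on the same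
datum (so `0641 →` piece is `fun h … _ => h …`, `pieces_of_luAlphaPTorsor`); no converse is known or claimed:
`StallStartLU` says nothing about kangaroo data (multiplicity `≥ p` after every shift), `ZenoLU` nothing about
data whose base sequence is infinitely thin (all discrete valuations, rung above) or whose run stalls.
WHY NOVEL (cell-relative): no node of lenses 1–6 / critic ledger rows 1–98 / TREE.md uses thinness, the
Jacobian VALUE budget, or the eternal/stall trichotomy on 0641; the g11 residual `KangarooCoreLU` (ω > 0 at the
base) is replaced by the strictly smaller located class `ZenoLU` (eternal AND finitely thin), its complement
inside the kangaroo core being absorbed into a DECIDED class (order-one-reaching runs, tree) and the ATTACKABLE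
class `StallStartLU` (later stalls, rebased) — with both transfers PROVED here, not posited.
REMARK (`p = 2`): KERNEL-CHECKED for PERFECT `k` in §9 (`not_stalled_two`, `tameStartLU_inst_two`,
`stallStartLU_inst_two`: a core-side datum is never stalled at its base, so T′ and T are vacuous there); ARGUED at
later stages (rebasing keeps `k`, `stallLU_iff_stallStartLU`).  So for `p = 2` over perfect `k` the WHOLE open
content of the host is `ZenoLU`: relative
uniformization of `α₂`-torsors along eternal, finitely thin quadratic sequences (modulo the tree anchor, whose
reductions are bundled over all `p`, so no `p = 2`-only kernel is stated).
REMARK (WHERE ZENO LIVES; model families, argued in NODE-g12.md §6, not kernel-checked).  Both sides of the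
thinness dichotomy are populated ON THE CORE SIDE.  For a rank-one, rational-rank-one, zero-dimensional valuation of
`k(x,y)` given by a generalized Puiseux arc `y = Σ cᵢ x^{γᵢ}` (`γ₁ < γ₂ < …` rationals with unbounded
denominators: non-discrete, non-Abhyankar, not dense over an Abhyankar base) the quadratic sequence is the
subtractive Euclidean algorithm on the exponent data; the phase between two translations contributes the
Puiseux JUMP `γᵢ₊₁ − γᵢ` plus a scale term, so the thinness is `Σₙ ν(𝔪ₙ) = (lim γᵢ −
γ₁) + O(1)`: finite iff
the exponents `γᵢ` stay BOUNDED.  `γᵢ → ∞` (a transcendental arc direction) is infinitely thin — there the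
budget law forbids eternal runs and the host reduces to `StallStartLU` — while `γᵢ ↑ γ_∞ < ∞` (infinitely many
jumps of summable size, the accumulating configuration of the classical defect examples) is finitely thin:
Zeno (worked check: `γᵢ = 1 − 2⁻ⁱ` gives `Σₙ ν(𝔪ₙ) = 2`).  So `ZenoLU` sits where the barrier catalogue puts
defect, and the census can measure thinness from the jump data of the PLACE without running the torsor.
PRIOR ART for the quantity: the
invariant `τ = Σₙ w(xₙ)` of an infinite sequence of local quadratic transforms (Heinzer–Olberding–Toeniskoetter,
J. Algebra 2017 = arXiv:1509.07545, Notation 5.11 p.10; `τ < ∞ ⟺` the Shannon extension is archimedean `⟺`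
dominated by a rank-one valuation, Thm. 6.1 «arch» p.3; finite-`τ` non-valuation examples Cor. 7.7 p.15) — taken
there w.r.t. the asymptotic order valuation `w`, here w.r.t. the place `O` itself, and never before coupled to a
Jacobian value budget or to torsor runs [corpus:paper:arxiv-1509.07545; no corpus/galaxy hit joins it to
uniformization: queries "Shannon extension|quadratic Shannon|local quadratic transforms" galaxy all = 0 relevant,
corpus fts+vec = HLOST/HOT only].
HONEST LIMIT: the node does not decide `ZenoLU`; finite thinness is a genuine restriction (it excludes every
discrete and, more generally, every infinitely thin base sequence) but the printed hard specimens
(Cossart–Piltant 2019 Rem. 3.2, Hauser–Perlega 2019) live at non-discrete rank-one valuations whose thinness along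
their base sequence the census has not measured — that is the census ask T-zeno of NODE-g12.md.

Imports are tree-only and hub-built (Theses.Valuative; Theorems FrobeniusClosingSteer{JacobianThinness,
Core4RunTrichotomy, Core4OrderOneExit, Core4GenExit}; ValuativeLuAlphaPTorsor{DenseRangeFinal, DimTwoTransport,
SequenceSchema, LogPrincipalizationLowDim, BirationalExit, DiscreteAllDimHelpers}; Mathlib.FieldTheory.{Perfect,
IntermediateField.Adjoin.Algebra}).  Nothing is re-typed from the tree: the run
vocabulary is `SteerRankThinness.*` BY NAME, the core side is the anchor's text verbatim; `IsBaseSequence` /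
`OrderOneAt` / `CanStep` are the three abbreviations the trichotomy file inlines.  0 sorry; no option lines beyond
the layout linter; `#print axioms closes` = propext · Classical.choice · Quot.sound.
-/

namespace Summit.ResolutionOfSingularities.ResolutionOfSingularities.Theorems.ThinnessCutClasses

open IsLocalRing
open Literature.AlgebraicGeometry.Resolution
open Summit.ResolutionOfSingularities.ResolutionOfSingularities.Theses
open Summit.ResolutionOfSingularities.ResolutionOfSingularities.Theorems
open Summit.ResolutionOfSingularities.ResolutionOfSingularities.Theorems.SteerRankThinness
  (IsExcParam IsStrictStep IsTorsorRunUpTo IsTorsorRun InfiniteThinness not_isTorsorRun_of_infiniteThinness)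
open scoped IntermediateField

variable {K : Type} [Field K]

/-! ## 1. Vocabulary (the three abbreviations the tree trichotomy inlines; everything else BY NAME) -/

/-- The CONCLUSION of the host for the datum `(A₀, t)`: some finitely generated `A ⊇ A₀` with `t ∈ A ⊆ O`,
`Frac A = K`, regular at the centre of `O` (verbatim the `∃`-clause of `Valuative.LuAlphaPTorsor`). (ours) -/
def Concl {k : Type} [Field k] [Algebra k K] (O : ValuationSubring K) (A₀ : Subalgebra k K) (t : K) : Prop :=
  ∃ (A : Subalgebra k K) (h : A.toSubring ≤ O.toSubring), A₀ ≤ A ∧ t ∈ A ∧ A.FG ∧ IsFractionRing A K ∧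
    IsRegularLocalRing (Localization.AtPrime (Ideal.comap (Subring.inclusion h) (maximalIdeal O)))

/-- `R` is the QUADRATIC SEQUENCE OF THE BASE `A₀` ALONG `O`: `R 0 = (A₀)_{𝔪_O ∩ A₀}` inside `K` and each
`R (i+1)` is the quadratic transform of `R i` along `O` (tree `IsQuadraticTransformAlong`; unique when it
exists, `IsQuadraticTransformAlong.unique`). [folklore] -/
def IsBaseSequence {k : Type} [Field k] [Algebra k K] (O : ValuationSubring K) (A₀ : Subalgebra k K)
    (R : ℕ → Subring K) : Prop :=
  R 0 = locAtCentre A₀.toSubring O ∧ ∀ i, IsQuadraticTransformAlong O (R i) (R (i + 1))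

/-- ORDER-ONE FORM of the radical `u` over the local ring `S ⊆ K`: `uᵖ − gᵖ` is a one-element part of a
regular system of parameters of `S` for some `g ∈ S` (the tree trichotomy's `OrderOneAt`, inlined there).
[folklore] -/
def OrderOneAt (S : Subring K) (p : ℕ) (u : K) : Prop :=
  ∃ g ∈ S, ∃ (_ : IsLocalRing S) (z : Fin 1 → S), IsRsopPart z ∧ ((z 0 : S) : K) = u ^ p - g ^ p

/-- The run `s` CAN STEP at stage `N`: some strict transform `s N = x · s' + g` (`x` an exceptional
parameter of `R N`, `g ∈ R N`) has `s'ᵖ ∈ R (N+1)` (the tree trichotomy's `CanStep`, inlined there; this is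
the KANGAROO condition at stage `N`). [folklore] -/
def CanStep (O : ValuationSubring K) (R : ℕ → Subring K) (p : ℕ) (s : ℕ → K) (N : ℕ) : Prop :=
  ∃ s' : K, IsStrictStep O (R N) (s N) s' ∧ s' ^ p ∈ R (N + 1)

/-- The DEFECT-CORE SIDE of the valuation (the four datum-free conditions of the tree anchor F⁹,
`PfaffLine.luAlphaPTorsor_iff_defectCoreFinal`, verbatim): `O` is ZERO-DIMENSIONAL over `k` (every element
of `O` satisfies a non-zero polynomial over `k` with value in the non-units), NOT an Abhyankar place of `K/k`,
NOT dense in a finitely generated Abhyankar subfunction field, and NOT discrete of rank one.  These depend on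
`(k, K, O)` only, so they pass unchanged through rebasing; the complementary ranges are tree theorems
(positive-dimensional / Abhyankar: Knaf–Kuhlmann, Cutkosky; dense: `denseRange3_crux`; discrete:
`luAlphaPTorsor_of_discrete`), booked at g11. [folklore] -/
def CoreSide (k K : Type) [Field k] [Field K] [Algebra k K] (O : ValuationSubring K) : Prop :=
  (∀ x : K, x ∈ O → ∃ f : Polynomial k, f ≠ 0 ∧ Polynomial.aeval x f ∈ O.nonunits) ∧
  ¬ IsAbhyankarPlace O (algebraMap k K).fieldRange ⊤ ∧
  ¬ (∃ F₀ : Subfield K, (algebraMap k K).fieldRange ≤ F₀ ∧ FGOver (algebraMap k K).fieldRange F₀ ∧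
      IsAbhyankarPlace O (algebraMap k K).fieldRange F₀ ∧
      ∀ x w : K, w ≠ 0 → ∃ a ∈ F₀, O.valuation (x - a) < O.valuation w) ∧
  ¬ (∃ π : K, π ≠ 0 ∧ O.valuation π < 1 ∧ ∀ z : K, z ≠ 0 → ∃ n : ℤ, O.valuation z = O.valuation π ^ n)

/-! ## 2. The pieces (each = the host restricted to the defect-core side and a run condition) -/

/-- **Piece T — `StallStartLU`** [WEAKER · UNDECIDED · ATTACKABLE-L].  Relative local uniformization of the
torsor for a CORE-SIDE datum (`CoreSide`) STALLED AT ITS BASE: along the base sequence `R`, the radical `t` admits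
NO strict step at
stage `0` (no `p`-th-power shift of `tᵖ` is divisible by the `p`-th power of the exceptional parameter in
`R 1`: the non-kangaroo regime) and is NOT in order-one form over `R 0`.  By `stallLU_iff_stallStartLU` this
single statement covers stalls at every later stage.  Engine foreseen (critic row 98, E2): multiplicity
`< p` ⇒ maximal contact (Kollár 2007, Aside 3.57) + a torsor-shaped coefficient ideal over a base of
dimension one less.  Why it might fail: the coefficient ideal along a non-Abhyankar valuation need not be
monomializable in dimension `≥ 4` (`DimensionFourFrontier`). (ours) -/
def StallStartLU : Prop :=
  ∀ p : ℕ, p.Prime → ∀ (k K : Type) [Field k] [CharP k p] [Field K] [Algebra k K]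
    (O : ValuationSubring K) (A₀ : Subalgebra k K) (h₀ : A₀.toSubring ≤ O.toSubring) (t : K),
    A₀.FG → t ^ p ∈ A₀ → IsFractionRing (Algebra.adjoin k (insert t (A₀ : Set K))) K →
    IsRegularLocalRing (Localization.AtPrime (Ideal.comap (Subring.inclusion h₀) (maximalIdeal O))) →
    CoreSide k K O →
    (∃ R : ℕ → Subring K, IsBaseSequence O A₀ R ∧
      ¬ CanStep O R p (fun _ => t) 0 ∧ ¬ OrderOneAt (R 0) p t) →
    Concl O A₀ t

/-- **`StallLU`** (recomposition, NOT a separate piece: `stallLU_iff_stallStartLU`).  The host for a datum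
whose run STALLS at some stage `N`: a strict run `s` of `t` up to `N` (tree `IsTorsorRunUpTo`) that can no
longer step and is not in order-one form at `N`. (ours) -/
def StallLU : Prop :=
  ∀ p : ℕ, p.Prime → ∀ (k K : Type) [Field k] [CharP k p] [Field K] [Algebra k K]
    (O : ValuationSubring K) (A₀ : Subalgebra k K) (h₀ : A₀.toSubring ≤ O.toSubring) (t : K),
    A₀.FG → t ^ p ∈ A₀ → IsFractionRing (Algebra.adjoin k (insert t (A₀ : Set K))) K →
    IsRegularLocalRing (Localization.AtPrime (Ideal.comap (Subring.inclusion h₀) (maximalIdeal O))) →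
    CoreSide k K O →
    (∃ R : ℕ → Subring K, IsBaseSequence O A₀ R ∧ ∃ (s : ℕ → K) (N : ℕ),
      IsTorsorRunUpTo O R t p s N ∧ ¬ CanStep O R p s N ∧ ¬ OrderOneAt (R N) p (s N)) →
    Concl O A₀ t

/-- **`EternalLU`** (recomposition, NOT a separate piece: `eternalLU_iff_zenoLU`).  The host for a datum
with an ETERNAL strict run of `t` along the base sequence (tree `IsTorsorRun`: the kangaroo condition holds
at every stage; this is where g11's `KangarooCoreLU` specimens that never stall and never reach order one
live). (ours) -/
def EternalLU : Prop :=
  ∀ p : ℕ, p.Prime → ∀ (k K : Type) [Field k] [CharP k p] [Field K] [Algebra k K]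
    (O : ValuationSubring K) (A₀ : Subalgebra k K) (h₀ : A₀.toSubring ≤ O.toSubring) (t : K),
    A₀.FG → t ^ p ∈ A₀ → IsFractionRing (Algebra.adjoin k (insert t (A₀ : Set K))) K →
    IsRegularLocalRing (Localization.AtPrime (Ideal.comap (Subring.inclusion h₀) (maximalIdeal O))) →
    CoreSide k K O →
    (∃ R : ℕ → Subring K, IsBaseSequence O A₀ R ∧ ∃ s : ℕ → K, IsTorsorRun O R t p s) →
    Concl O A₀ t

/-- **Piece Z — `ZenoLU`** [located residual · WEAKER · UNDECIDED · IDEA-NEEDED / BARRIER].  The host for a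
CORE-SIDE datum with an eternal strict run of `t` along a base sequence of FINITE THINNESS (`¬ InfiniteThinness`:
some non-zero value is never undercut by a finite product of exceptional values — the exceptional divisors
accumulate only a bounded amount of value, the «Zeno» regime of an infinitely singular valuation).  By the
law `eternalLU_iff_zenoLU` finite thinness is FORCED in the eternal case, so this is exactly the open
content of `EternalLU`.  Barriers (honest): Cossart 2011 (no maximal contact at order `p` along a valuation),
`DimensionFourFrontier`; the bet is that bounded thinness makes the sequence of centres converge to a formal
branch along which the torsor is analytically a `p`-th power (a Zeno valuation is «almost divisorial after
finitely many steps»), which no printed engine exploits. (ours) -/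
def ZenoLU : Prop :=
  ∀ p : ℕ, p.Prime → ∀ (k K : Type) [Field k] [CharP k p] [Field K] [Algebra k K]
    (O : ValuationSubring K) (A₀ : Subalgebra k K) (h₀ : A₀.toSubring ≤ O.toSubring) (t : K),
    A₀.FG → t ^ p ∈ A₀ → IsFractionRing (Algebra.adjoin k (insert t (A₀ : Set K))) K →
    IsRegularLocalRing (Localization.AtPrime (Ideal.comap (Subring.inclusion h₀) (maximalIdeal O))) →
    CoreSide k K O →
    (∃ R : ℕ → Subring K, IsBaseSequence O A₀ R ∧ ¬ InfiniteThinness O R ∧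
      ∃ s : ℕ → K, IsTorsorRun O R t p s) →
    Concl O A₀ t

/-! ## 3. Necessity: every piece is the host restricted (weaker BY LETTER) -/

/-- The host, unfolded to `Concl` (definitional). (ours) [folklore] -/
theorem luAlphaPTorsor_iff_concl : Valuative.LuAlphaPTorsor ↔
    ∀ p : ℕ, p.Prime → ∀ (k K : Type) [Field k] [CharP k p] [Field K] [Algebra k K]
      (O : ValuationSubring K) (A₀ : Subalgebra k K) (h₀ : A₀.toSubring ≤ O.toSubring) (t : K),
      A₀.FG → t ^ p ∈ A₀ → IsFractionRing (Algebra.adjoin k (insert t (A₀ : Set K))) K →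
      IsRegularLocalRing (Localization.AtPrime (Ideal.comap (Subring.inclusion h₀) (maximalIdeal O))) →
      Concl O A₀ t :=
  Iff.rfl

/-- `0641 ⟹` every piece and recomposition (each is a restriction of the host). (ours) [folklore] -/
theorem pieces_of_luAlphaPTorsor (h : Valuative.LuAlphaPTorsor) :
    StallStartLU ∧ StallLU ∧ EternalLU ∧ ZenoLU :=
  ⟨fun p hp k K _ _ _ _ O A₀ h₀ t hfg htp hfr hreg _ _ => h p hp k K O A₀ h₀ t hfg htp hfr hreg,
    fun p hp k K _ _ _ _ O A₀ h₀ t hfg htp hfr hreg _ _ => h p hp k K O A₀ h₀ t hfg htp hfr hreg,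
    fun p hp k K _ _ _ _ O A₀ h₀ t hfg htp hfr hreg _ _ => h p hp k K O A₀ h₀ t hfg htp hfr hreg,
    fun p hp k K _ _ _ _ O A₀ h₀ t hfg htp hfr hreg _ _ => h p hp k K O A₀ h₀ t hfg htp hfr hreg⟩

/-! ## 4. Decided in tree: order-one stages (no piece) -/

/-- **Order-one stages are decided** (tree `SwitchingDichotomy.orderOneExit`, consumed by definitional
unfolding of `IsTorsorRunUpTo` / `IsStrictStep` / `IsExcParam` / `OrderOneAt`).
[folklore] (Sources: HeinzerEtAl2015, Prop. 4.4.) -/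
theorem orderOne_concl (p : ℕ) (hp : p.Prime) (k K : Type) [Field k] [CharP k p] [Field K] [Algebra k K]
    (O : ValuationSubring K) (A₀ : Subalgebra k K) (h₀ : A₀.toSubring ≤ O.toSubring) (t : K)
    (hfg : A₀.FG) (htp : t ^ p ∈ A₀) (hfr : IsFractionRing (Algebra.adjoin k (insert t (A₀ : Set K))) K)
    (hreg : IsRegularLocalRing
      (Localization.AtPrime (Ideal.comap (Subring.inclusion h₀) (maximalIdeal O))))
    {R : ℕ → Subring K} (hR : IsBaseSequence O A₀ R) {s : ℕ → K} {N : ℕ}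
    (hrun : IsTorsorRunUpTo O R t p s N) (hone : OrderOneAt (R N) p (s N)) : Concl O A₀ t :=
  SwitchingDichotomy.orderOneExit p hp k K O A₀ h₀ t hfg htp hfr hreg R hR.1 hR.2 s N hrun hone

/-! ## 5. Stalls at any stage are stalls at the base of a rebased datum (PROVED transfer) -/

/-- **`StallLU ↔ StallStartLU`.**  (→) a stall at the base is a stall at stage `0` of the constant run.
(←) a stall at stage `N` of `(A₀, t)` is a stall at stage `0` of the REBASED datum `(A', s N)` along the
shifted sequence `i ↦ R (N + i)` (tree `SwitchingDichotomy.genRebase`: `A'` finitely generated, regular at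
the centre with local ring `R N`, `(s N)ᵖ ∈ A'`, `t ∈ A'[s N]`, `Frac (A'[s N]) = K`, and regular models of
`(A', s N)` push down to regular models of `(A₀, t)`). [folklore] -/
theorem stallLU_iff_stallStartLU : StallLU ↔ StallStartLU := by
  constructor
  · intro hS p hp k K _ _ _ _ O A₀ h₀ t hfg htp hfr hreg hcs hst
    obtain ⟨R, hbase, hcan, hone⟩ := hst
    refine hS p hp k K O A₀ h₀ t hfg htp hfr hreg hcs ⟨R, hbase, fun _ => t, 0,
      ⟨rfl, fun i hi => ?_, fun i hi => absurd hi (Nat.not_lt_zero i)⟩, hcan, hone⟩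
    obtain rfl : i = 0 := Nat.le_zero.mp hi
    rw [hbase.1]
    exact le_locAtCentre A₀.toSubring O htp
  · intro hT p hp k K _ _ _ _ O A₀ h₀ t hfg htp hfr hreg hcs hst
    obtain ⟨R, ⟨hR0, hRq⟩, s, N, hrun, hcan, hone⟩ := hst
    classical
    have hsNp : s N ^ p ∈ R N := hrun.2.1 N le_rfl
    obtain ⟨X, hX, G, hG, htXG⟩ :=
      SwitchingDichotomy.OrderOneExit.exists_eq_mul_add_of_run O (sequence_monotone hRq) hrun
    have htcl : t ∈ Subring.closure (insert (s N) (R N : Set K)) := by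
      rw [htXG]
      exact Subring.add_mem _
        (Subring.mul_mem _ (Subring.subset_closure (Set.mem_insert_of_mem _ hX))
          (Subring.subset_closure (Set.mem_insert _ _)))
        (Subring.subset_closure (Set.mem_insert_of_mem _ hG))
    obtain ⟨A', h', -, hRN, hfg', hsp', -, hfr', hreg', hpush⟩ :=
      SwitchingDichotomy.genRebase p k K O A₀ h₀ t hfg htp hfr hreg R hR0 hRq N (s N) hsNp htcl
    apply hpush
    refine hT p hp k K O A' h' (s N) hfg' hsp' hfr' hreg' hcs
      ⟨fun i => R (N + i), ⟨hRN.symm, fun i => hRq (N + i)⟩, ?_, ?_⟩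
    · rintro ⟨s', hst, hs'⟩
      exact hcan ⟨s', hst, hs'⟩
    · exact hone


end Summit.ResolutionOfSingularities.ResolutionOfSingularities.Theorems.ThinnessCutClasses
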